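import Summits.CriticalPhenomena.PercolationContinuityZ3.Theorems.PercNearOneGluingNoHeavyLowerTailKNGoodPocketBHKSetSource
import HarnessLib

/-!
# `NoHeavyLowerTail` (stmt-CriticalPhenomena-4575) — the pocket-augmented BHK inequality, SINK form, and
# Kozma–Nitzan's superadditivity (their Lemma 2) for pocket-augmented events

Support file (`--supports stmt-CriticalPhenomena-4575`, hull-port prover `prim-hp-2`, gen 23).  No definitions of
mathematical objects beyond two abbreviations-free theorems, no named facts, no sorries; standard axioms.

(II) (`KNGoodPocketBHK.real_pocketAugSet_inter_ge`): given `D = {S ↮ T}`, the pocket-augmented event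
`F_S = {o ↔ S} ∪ {C(o) ∈ 𝒬}` (`𝒬` disjoint from `T`) is POSITIVELY correlated with every increasing event of the cluster of `S`.
This file adds:

* `KNGoodPocketBHK.real_pocketAugSet_sink_le` — **(II)′, the sink form**: given `D`, `F_S` is NEGATIVELY correlated with every
  increasing event `g` of the cluster of the SINK `T`:  `μ(D)·μ(g ∩ F_S ∩ D) ≤ μ(g ∩ D)·μ(F_S ∩ D)`.  Proof: (II) for the source `T`,
  the sink `S` and the complementary family `{W : W ∩ S = ∅, W ∉ 𝒬}`, whose pocket-augmented event is the complement of `F_S`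
  inside `D` (`pocketAugSet_compl_inter_avoidSet`).
* `KNGoodPocketBHK.pocket_superadditive` — the pocket version of Kozma–Nitzan's superadditivity lemma
  (arXiv:2401.12397, Lemma 2 p. 6) for two relays `a, t` against a third `c`:
  `P(F_a | a ↮ {t,c}) + P(F_t | t ↮ {a,c}) ≤ P(F_{at} | {a,t} ↮ c)` (product form), where
  `F_a = {o↔a} ∪ {C(o) ∈ 𝒬_a}`, `F_t = {o↔t} ∪ {C(o) ∈ 𝒬_t}`, `F_{at} = {o ↔ {a,t}} ∪ {C(o) ∈ 𝒬_a ∪ 𝒬_t}` for disjoint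
  families `𝒬_a ∌∋ t, c`, `𝒬_t ∌∋ a, c`.  Proof: KN's proof word for word with (II)/(II)′ in place of BHK: conditioning further on
  the separation event `M = {a, t, c pairwise separated}` raises each single rate ((II)′), the two events are disjoint on `M`
  with union `F_{at}`, and `P(F_{at} | M) ≤ P(F_{at} | {a,t} ↮ c)` ((II) with the increasing event `{a ↔ t}`).
These are steps (3) and the "down" halves of step (2) of the pocket lift of Kozma–Nitzan's Theorem 2 (prim-hp-2 MEMO-gen23 §8).
[cite: VandenbergHaggstromKahn2005, Thm. 1.1 (pp. 3–5), Remark 1 (p. 5)] [cite: KozmaNitzan2024, Lemma 1–2 (pp. 5–6), Thm. 2 (p. 8)]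
-/

noncomputable section

namespace Summit.CriticalPhenomena.PercolationContinuityZ3.Theorems

open MeasureTheory Set Literature.Probability.LatticeModels Literature.Probability.Percolation
open scoped Classical

namespace KNGoodPocketBHK

variable {V : Type*} [Fintype V]

omit [Fintype V] in
/-- `{S ↮ T} = {T ↮ S}`. [folklore] -/
theorem avoidSet_comm (S T : Set V) : avoidSet S T = avoidSet T S := by
  ext ω
  simp only [avoidSet, Set.mem_setOf_eq]
  constructor
  · intro h t ht s hs hts
    exact h s hs t ht hts.symm
  · intro h s hs t ht hst
    exact h t ht s hs hst.symm

omit [Fintype V] in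
/-- `{S ↮ T}` is a decreasing event. [folklore] -/
theorem isLowerSet_avoidSet (S T : Set V) : IsLowerSet (avoidSet S T : Set (BondConfig V)) := by
  intro ω ω' hle hω s hs t ht h'
  exact hω s hs t ht (isUpperSet_openConn s t hle h')

omit [Fintype V] in
/-- **The complementary family.**  Inside `D = {S ↮ T}`, the pocket-augmented event of the source `T` with the family
`{W : W ∩ S = ∅, W ∉ 𝒬}` is the complement of the pocket-augmented event of the source `S` with the family `𝒬`
(`𝒬` disjoint from `T`). [cite: KozmaNitzan2024, §3.2 (p. 12)] -/
theorem pocketAugSet_compl_inter_avoidSet (S T : Set V) (o : V) (Q : Set (Set V))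
    (hQ : ∀ W ∈ Q, Disjoint W T) :
    pocketAugSet T o {W | Disjoint W S ∧ W ∉ Q} ∩ avoidSet S T = avoidSet S T \ pocketAugSet S o Q := by
  ext ω
  simp only [pocketAugSet, avoidSet, Set.mem_inter_iff, Set.mem_sdiff, Set.mem_setOf_eq]
  constructor
  · rintro ⟨hF', hD⟩
    refine ⟨hD, ?_⟩
    rintro (⟨s, hs, hos⟩ | hQm)
    · rcases hF' with ⟨t, ht, hot⟩ | ⟨hdisj, -⟩
      · exact hD s hs t ht (hos.symm.trans hot)
      · exact (Set.disjoint_left.1 hdisj) (show s ∈ openCluster ω o from hos) hs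
    · rcases hF' with ⟨t, ht, hot⟩ | ⟨-, hnot⟩
      · exact (Set.disjoint_left.1 (hQ _ hQm)) (show t ∈ openCluster ω o from hot) ht
      · exact hnot hQm
  · rintro ⟨hD, hnF⟩
    refine ⟨Or.inr ⟨?_, fun hq => hnF (Or.inr hq)⟩, hD⟩
    rw [Set.disjoint_left]
    intro s hso hs
    exact hnF (Or.inl ⟨s, hs, hso⟩)

/-- **(II)′ — the pocket-augmented BHK inequality, sink form.**  For vertex sets `S, T`, a vertex `o`, a family `𝒬` of vertex
sets disjoint from `T`, and any event `g` increasing in and determined by `C_T = ⋃_{t ∈ T} C_t`, with `D = {S ↮ T}` and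
`F = {o ↔ S} ∪ {C(o) ∈ 𝒬}`:  `μ(D) · μ(g ∩ F ∩ D) ≤ μ(g ∩ D) · μ(F ∩ D)` — given `D`, `F` is negatively correlated with `g`.
[cite: VandenbergHaggstromKahn2005, Thm. 1.1 (pp. 3–5), Remark 1 (p. 5)] [cite: KozmaNitzan2024, Lemma 1 (p. 5), §3.2 (p. 12)] -/
theorem real_pocketAugSet_sink_le (w : Sym2 V → unitInterval) (S T : Set V) (o : V)
    (Q : Set (Set V)) (hQ : ∀ W ∈ Q, Disjoint W T) (g : Set (BondConfig V))
    (hg : ∀ ω ω', ω ∈ g → (⋃ t ∈ T, openEdgeCluster ω t) ⊆ (⋃ t ∈ T, openEdgeCluster ω' t) → ω' ∈ g) :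
    (prodBernoulli w).real (avoidSet S T) * (prodBernoulli w).real (g ∩ (pocketAugSet S o Q ∩ avoidSet S T)) ≤
      (prodBernoulli w).real (g ∩ avoidSet S T) *
        (prodBernoulli w).real (pocketAugSet S o Q ∩ avoidSet S T) := by
  classical
  set μ := prodBernoulli w with hμ
  have hmeas : ∀ A : Set (BondConfig V), MeasurableSet A := fun _ => MeasurableSet.of_discrete
  set Q' : Set (Set V) := {W | Disjoint W S ∧ W ∉ Q} with hQ'
  have hQ'S : ∀ W ∈ Q', Disjoint W S := fun W hW => hW.1
  have key := real_pocketAugSet_inter_ge w T S o Q' hQ'S g hg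
  rw [← hμ] at key
  rw [avoidSet_comm T S] at key
  set D : Set (BondConfig V) := avoidSet S T with hD
  set F : Set (BondConfig V) := pocketAugSet S o Q with hF
  have hc : pocketAugSet T o Q' ∩ D = D \ F := by
    rw [hQ', hD, hF]; exact pocketAugSet_compl_inter_avoidSet S T o Q hQ
  rw [hc] at key
  have e1 : μ.real (D \ F) = μ.real D - μ.real (F ∩ D) := by
    have h := measureReal_inter_add_sdiff (μ := μ) (s := D) (t := F) (hmeas _)
    rw [Set.inter_comm] at h
    linarith
  have e2 : μ.real (g ∩ (D \ F)) = μ.real (g ∩ D) - μ.real (g ∩ (F ∩ D)) := by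
    have h := measureReal_inter_add_sdiff (μ := μ) (s := g ∩ D) (t := F) (hmeas _)
    have h1 : g ∩ D ∩ F = g ∩ (F ∩ D) := by
      ext ω; simp only [Set.mem_inter_iff]; tauto
    have h2 : (g ∩ D) \ F = g ∩ (D \ F) := by
      ext ω; simp only [Set.mem_inter_iff, Set.mem_sdiff]; tauto
    rw [h1, h2] at h
    linarith
  rw [e1, e2] at key
  nlinarith [key]

/-! ### Kozma–Nitzan's superadditivity for pocket-augmented events -/

/-- **Pocket superadditivity** (Kozma–Nitzan's Lemma 2 for pocket-augmented events, two relays `a, t` against `c`), product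
form of `P(F_a | a ↮ {t,c}) + P(F_t | t ↮ {a,c}) ≤ P(F_{at} | {a,t} ↮ c)`:
with `D_a = {a ↮ {t,c}}`, `D_t = {t ↮ {a,c}}`, `D_K = {{a,t} ↮ c}`,
`μ(F_a ∩ D_a)·μ(D_t)·μ(D_K) + μ(F_t ∩ D_t)·μ(D_a)·μ(D_K) ≤ μ(F_{at} ∩ D_K)·μ(D_a)·μ(D_t)`.
[cite: KozmaNitzan2024, Lemma 2 (p. 6)] [cite: VandenbergHaggstromKahn2005, Thm. 1.1 (pp. 3–5)] -/
theorem pocket_superadditive (w : Sym2 V → unitInterval) (o a t c : V) (Qa Qt : Set (Set V))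
    (hQa : ∀ W ∈ Qa, t ∉ W ∧ c ∉ W) (hQt : ∀ W ∈ Qt, a ∉ W ∧ c ∉ W) (hdis : Disjoint Qa Qt) :
    (prodBernoulli w).real (pocketAugSet {a} o Qa ∩ avoidSet {a} {t, c}) *
          (prodBernoulli w).real (avoidSet {t} {a, c}) * (prodBernoulli w).real (avoidSet {a, t} {c}) +
        (prodBernoulli w).real (pocketAugSet {t} o Qt ∩ avoidSet {t} {a, c}) *
          (prodBernoulli w).real (avoidSet {a} {t, c}) * (prodBernoulli w).real (avoidSet {a, t} {c}) ≤
      (prodBernoulli w).real (pocketAugSet {a, t} o (Qa ∪ Qt) ∩ avoidSet {a, t} {c}) *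
        (prodBernoulli w).real (avoidSet {a} {t, c}) * (prodBernoulli w).real (avoidSet {t} {a, c}) := by
  classical
  set μ := prodBernoulli w with hμ
  haveI : IsProbabilityMeasure μ := by rw [hμ]; infer_instance
  have hmeas : ∀ A : Set (BondConfig V), MeasurableSet A := fun _ => MeasurableSet.of_discrete
  -- events
  set Da : Set (BondConfig V) := avoidSet {a} {t, c} with hDa
  set Dt : Set (BondConfig V) := avoidSet {t} {a, c} with hDt
  set DK : Set (BondConfig V) := avoidSet {a, t} {c} with hDK
  set Fa : Set (BondConfig V) := pocketAugSet {a} o Qa with hFa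
  set Ft : Set (BondConfig V) := pocketAugSet {t} o Qt with hFt
  set F : Set (BondConfig V) := pocketAugSet {a, t} o (Qa ∪ Qt) with hF
  set M : Set (BondConfig V) := {ω | ¬ (openGraph ω).Reachable a t ∧ ¬ (openGraph ω).Reachable a c ∧
    ¬ (openGraph ω).Reachable t c} with hM
  -- membership lemmas
  have memDa : ∀ ω, ω ∈ Da ↔ ¬ (openGraph ω).Reachable a t ∧ ¬ (openGraph ω).Reachable a c := fun ω => by
    simp only [hDa, avoidSet, Set.mem_setOf_eq, Set.mem_singleton_iff, Set.mem_insert_iff, forall_eq,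
      forall_eq_or_imp]
  have memDt : ∀ ω, ω ∈ Dt ↔ ¬ (openGraph ω).Reachable t a ∧ ¬ (openGraph ω).Reachable t c := fun ω => by
    simp only [hDt, avoidSet, Set.mem_setOf_eq, Set.mem_singleton_iff, Set.mem_insert_iff, forall_eq,
      forall_eq_or_imp]
  have memDK : ∀ ω, ω ∈ DK ↔ ¬ (openGraph ω).Reachable a c ∧ ¬ (openGraph ω).Reachable t c := fun ω => by
    simp only [hDK, avoidSet, Set.mem_setOf_eq, Set.mem_singleton_iff, Set.mem_insert_iff, forall_eq,
      forall_eq_or_imp]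
  have memFa : ∀ ω, ω ∈ Fa ↔ (openGraph ω).Reachable o a ∨ openCluster ω o ∈ Qa := fun ω => by
    simp only [hFa, pocketAugSet, Set.mem_setOf_eq, Set.mem_singleton_iff, exists_eq_left]
  have memFt : ∀ ω, ω ∈ Ft ↔ (openGraph ω).Reachable o t ∨ openCluster ω o ∈ Qt := fun ω => by
    simp only [hFt, pocketAugSet, Set.mem_setOf_eq, Set.mem_singleton_iff, exists_eq_left]
  have memF : ∀ ω, ω ∈ F ↔ ((openGraph ω).Reachable o a ∨ (openGraph ω).Reachable o t) ∨
      (openCluster ω o ∈ Qa ∨ openCluster ω o ∈ Qt) := fun ω => by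
    simp only [hF, pocketAugSet, Set.mem_setOf_eq, Set.mem_singleton_iff, Set.mem_insert_iff, Set.mem_union,
      exists_eq_or_imp, exists_eq_left]
  -- `M` as a slice of each `D`
  have hMa : M = Da \ openConn t c := by
    ext ω
    simp only [hM, Set.mem_setOf_eq, Set.mem_sdiff, memDa, openConn]
    tauto
  have hMt : M = Dt \ openConn a c := by
    ext ω
    simp only [hM, Set.mem_setOf_eq, Set.mem_sdiff, memDt, openConn]
    constructor
    · rintro ⟨h1, h2, h3⟩; exact ⟨⟨fun h => h1 h.symm, h3⟩, h2⟩
    · rintro ⟨⟨h1, h3⟩, h2⟩; exact ⟨fun h => h1 h.symm, h2, h3⟩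
  have hMK : M = DK \ openConn a t := by
    ext ω
    simp only [hM, Set.mem_setOf_eq, Set.mem_sdiff, memDK, openConn]
    tauto
  ---------------------------------------------------------------- step 1a: μ(Fa ∩ Da)·μ(M) ≤ μ(Fa ∩ M)·μ(Da)
  have hQa' : ∀ W ∈ Qa, Disjoint W ({t, c} : Set V) := by
    intro W hW
    rw [Set.disjoint_left]
    intro x hxW hx
    rcases hx with rfl | hx
    · exact (hQa W hW).1 hxW
    · rw [Set.mem_singleton_iff] at hx; subst hx; exact (hQa W hW).2 hxW
  have hg_tc : ∀ ω ω' : BondConfig V, ω ∈ openConn t c →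
      (⋃ x ∈ ({t, c} : Set V), openEdgeCluster ω x) ⊆ (⋃ x ∈ ({t, c} : Set V), openEdgeCluster ω' x) →
      ω' ∈ openConn t c := openConn_determinedBy_biUnion {t, c} (by simp) c
  have s1a : μ.real (Fa ∩ Da) * μ.real M ≤ μ.real (Fa ∩ M) * μ.real Da := by
    have key := real_pocketAugSet_sink_le w {a} {t, c} o Qa hQa' (openConn t c) hg_tc
    rw [← hμ] at key
    change μ.real Da * μ.real (openConn t c ∩ (Fa ∩ Da)) ≤ μ.real (openConn t c ∩ Da) * μ.real (Fa ∩ Da) at key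
    have e1 : μ.real M = μ.real Da - μ.real (openConn t c ∩ Da) := by
      have h := measureReal_inter_add_sdiff (μ := μ) (s := Da) (t := openConn t c) (hmeas _)
      rw [hMa, Set.inter_comm]; linarith
    have e2 : μ.real (Fa ∩ M) = μ.real (Fa ∩ Da) - μ.real (openConn t c ∩ (Fa ∩ Da)) := by
      have h := measureReal_inter_add_sdiff (μ := μ) (s := Fa ∩ Da) (t := openConn t c) (hmeas _)
      have h1 : Fa ∩ Da ∩ openConn t c = openConn t c ∩ (Fa ∩ Da) := Set.inter_comm _ _
      have h2 : (Fa ∩ Da) \ openConn t c = Fa ∩ M := by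
        rw [hMa]; ext ω; simp only [Set.mem_inter_iff, Set.mem_sdiff]; tauto
      rw [h1, h2] at h; linarith
    rw [e1, e2]; nlinarith [key]
  ---------------------------------------------------------------- step 1t
  have hQt' : ∀ W ∈ Qt, Disjoint W ({a, c} : Set V) := by
    intro W hW
    rw [Set.disjoint_left]
    intro x hxW hx
    rcases hx with rfl | hx
    · exact (hQt W hW).1 hxW
    · rw [Set.mem_singleton_iff] at hx; subst hx; exact (hQt W hW).2 hxW
  have hg_ac : ∀ ω ω' : BondConfig V, ω ∈ openConn a c →
      (⋃ x ∈ ({a, c} : Set V), openEdgeCluster ω x) ⊆ (⋃ x ∈ ({a, c} : Set V), openEdgeCluster ω' x) →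
      ω' ∈ openConn a c := openConn_determinedBy_biUnion {a, c} (by simp) c
  have s1t : μ.real (Ft ∩ Dt) * μ.real M ≤ μ.real (Ft ∩ M) * μ.real Dt := by
    have key := real_pocketAugSet_sink_le w {t} {a, c} o Qt hQt' (openConn a c) hg_ac
    rw [← hμ] at key
    change μ.real Dt * μ.real (openConn a c ∩ (Ft ∩ Dt)) ≤ μ.real (openConn a c ∩ Dt) * μ.real (Ft ∩ Dt) at key
    have e1 : μ.real M = μ.real Dt - μ.real (openConn a c ∩ Dt) := by
      have h := measureReal_inter_add_sdiff (μ := μ) (s := Dt) (t := openConn a c) (hmeas _)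
      rw [hMt, Set.inter_comm]; linarith
    have e2 : μ.real (Ft ∩ M) = μ.real (Ft ∩ Dt) - μ.real (openConn a c ∩ (Ft ∩ Dt)) := by
      have h := measureReal_inter_add_sdiff (μ := μ) (s := Ft ∩ Dt) (t := openConn a c) (hmeas _)
      have h1 : Ft ∩ Dt ∩ openConn a c = openConn a c ∩ (Ft ∩ Dt) := Set.inter_comm _ _
      have h2 : (Ft ∩ Dt) \ openConn a c = Ft ∩ M := by
        rw [hMt]; ext ω; simp only [Set.mem_inter_iff, Set.mem_sdiff]; tauto
      rw [h1, h2] at h; linarith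
    rw [e1, e2]; nlinarith [key]
  ---------------------------------------------------------------- step 2: on `M` the two events are disjoint with union `F`
  have s2 : μ.real (Fa ∩ M) + μ.real (Ft ∩ M) = μ.real (F ∩ M) := by
    have hdisjM : Disjoint (Fa ∩ M) (Ft ∩ M) := by
      rw [Set.disjoint_left]
      rintro ω ⟨hFa', hM'⟩ ⟨hFt', -⟩
      rw [memFa] at hFa'; rw [memFt] at hFt'
      have hM'' : ¬ (openGraph ω).Reachable a t := by rw [hM] at hM'; exact hM'.1
      rcases hFa' with hoa | hqa
      · rcases hFt' with hot | hqt
        · exact hM'' (hoa.symm.trans hot)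
        · exact (hQt _ hqt).1 (show a ∈ openCluster ω o from hoa)
      · rcases hFt' with hot | hqt
        · exact (hQa _ hqa).1 (show t ∈ openCluster ω o from hot)
        · exact (Set.disjoint_left.1 hdis) hqa hqt
    have hun : F ∩ M = (Fa ∩ M) ∪ (Ft ∩ M) := by
      ext ω
      simp only [Set.mem_inter_iff, Set.mem_union, memF, memFa, memFt]
      tauto
    rw [hun, measureReal_union hdisjM (hmeas _)]
  ---------------------------------------------------------------- step 3: μ(F ∩ M)·μ(DK) ≤ μ(F ∩ DK)·μ(M)
  have hQc : ∀ W ∈ Qa ∪ Qt, Disjoint W ({c} : Set V) := by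
    rintro W (hW | hW)
    · exact Set.disjoint_singleton_right.2 (hQa W hW).2
    · exact Set.disjoint_singleton_right.2 (hQt W hW).2
  have s3 : μ.real (F ∩ M) * μ.real DK ≤ μ.real (F ∩ DK) * μ.real M := by
    have key := real_pocketAugSet_openConn_ge w ({a, t} : Set V) {c} a t o (by simp) (Qa ∪ Qt) hQc
    rw [← hμ] at key
    change μ.real (openConn a t ∩ DK) * μ.real (F ∩ DK) ≤ μ.real DK * μ.real (openConn a t ∩ (F ∩ DK)) at key
    have e1 : μ.real M = μ.real DK - μ.real (openConn a t ∩ DK) := by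
      have h := measureReal_inter_add_sdiff (μ := μ) (s := DK) (t := openConn a t) (hmeas _)
      rw [hMK, Set.inter_comm]; linarith
    have e2 : μ.real (F ∩ M) = μ.real (F ∩ DK) - μ.real (openConn a t ∩ (F ∩ DK)) := by
      have h := measureReal_inter_add_sdiff (μ := μ) (s := F ∩ DK) (t := openConn a t) (hmeas _)
      have h1 : F ∩ DK ∩ openConn a t = openConn a t ∩ (F ∩ DK) := Set.inter_comm _ _
      have h2 : (F ∩ DK) \ openConn a t = F ∩ M := by
        rw [hMK]; ext ω; simp only [Set.mem_inter_iff, Set.mem_sdiff]; tauto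
      rw [h1, h2] at h; linarith
    rw [e1, e2]; nlinarith [key]
  ---------------------------------------------------------------- step 4: combine
  have h0Da : 0 ≤ μ.real Da := measureReal_nonneg
  have h0Dt : 0 ≤ μ.real Dt := measureReal_nonneg
  have h0DK : 0 ≤ μ.real DK := measureReal_nonneg
  have h0M : 0 ≤ μ.real M := measureReal_nonneg
  have hFaDa : μ.real (Fa ∩ Da) ≤ μ.real Da := measureReal_mono inter_subset_right
  have hFtDt : μ.real (Ft ∩ Dt) ≤ μ.real Dt := measureReal_mono inter_subset_right
  have h0FaDa : 0 ≤ μ.real (Fa ∩ Da) := measureReal_nonneg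
  have h0FtDt : 0 ≤ μ.real (Ft ∩ Dt) := measureReal_nonneg
  have h0FDK : 0 ≤ μ.real (F ∩ DK) := measureReal_nonneg
  -- `μ(M) · LHS ≤ μ(M) · RHS`
  have hchain : μ.real M * (μ.real (Fa ∩ Da) * μ.real Dt * μ.real DK + μ.real (Ft ∩ Dt) * μ.real Da * μ.real DK) ≤
      μ.real M * (μ.real (F ∩ DK) * μ.real Da * μ.real Dt) := by
    have t1 : μ.real (Fa ∩ Da) * μ.real M * (μ.real Dt * μ.real DK) ≤
        μ.real (Fa ∩ M) * μ.real Da * (μ.real Dt * μ.real DK) :=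
      mul_le_mul_of_nonneg_right s1a (mul_nonneg h0Dt h0DK)
    have t2 : μ.real (Ft ∩ Dt) * μ.real M * (μ.real Da * μ.real DK) ≤
        μ.real (Ft ∩ M) * μ.real Dt * (μ.real Da * μ.real DK) :=
      mul_le_mul_of_nonneg_right s1t (mul_nonneg h0Da h0DK)
    have t3 : μ.real (F ∩ M) * μ.real DK * (μ.real Da * μ.real Dt) ≤
        μ.real (F ∩ DK) * μ.real M * (μ.real Da * μ.real Dt) :=
      mul_le_mul_of_nonneg_right s3 (mul_nonneg h0Da h0Dt)
    calc μ.real M * (μ.real (Fa ∩ Da) * μ.real Dt * μ.real DK + μ.real (Ft ∩ Dt) * μ.real Da * μ.real DK)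
        = μ.real (Fa ∩ Da) * μ.real M * (μ.real Dt * μ.real DK) +
            μ.real (Ft ∩ Dt) * μ.real M * (μ.real Da * μ.real DK) := by ring
      _ ≤ μ.real (Fa ∩ M) * μ.real Da * (μ.real Dt * μ.real DK) +
            μ.real (Ft ∩ M) * μ.real Dt * (μ.real Da * μ.real DK) := add_le_add t1 t2
      _ = (μ.real (Fa ∩ M) + μ.real (Ft ∩ M)) * (μ.real Da * μ.real Dt * μ.real DK) := by ring
      _ = μ.real (F ∩ M) * μ.real DK * (μ.real Da * μ.real Dt) := by rw [s2]; ring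
      _ ≤ μ.real (F ∩ DK) * μ.real M * (μ.real Da * μ.real Dt) := t3
      _ = μ.real M * (μ.real (F ∩ DK) * μ.real Da * μ.real Dt) := by ring
  by_cases hM0 : μ.real M = 0
  · -- degenerate: Harris gives `μ(Da)·μ({t ↮ c}) ≤ μ(M) = 0`, and `Dt ⊆ {t ↮ c}`
    have hlow₁ : IsLowerSet Da := by rw [hDa]; exact isLowerSet_avoidSet _ _
    have hlow₂ : IsLowerSet ((openConn t c : Set (BondConfig V))ᶜ) := (isUpperSet_openConn t c).compl
    have harris := prodBernoulli_harris_lower w hlow₁ hlow₂ (hmeas _) (hmeas _)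
    rw [← hμ] at harris
    have hMeq : Da ∩ (openConn t c)ᶜ = M := by rw [hMa, Set.sdiff_eq]
    change μ.real Da * μ.real ((openConn t c)ᶜ) ≤ μ.real (Da ∩ (openConn t c)ᶜ) at harris
    rw [hMeq, hM0] at harris
    have hDtle : μ.real Dt ≤ μ.real ((openConn t c : Set (BondConfig V))ᶜ) := by
      refine measureReal_mono (fun ω hω => ?_)
      rw [memDt] at hω
      simpa only [Set.mem_compl_iff, openConn, Set.mem_setOf_eq] using hω.2
    have h0c : 0 ≤ μ.real ((openConn t c : Set (BondConfig V))ᶜ) := measureReal_nonneg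
    rcases mul_eq_zero.1 (le_antisymm harris (mul_nonneg h0Da h0c)) with h | h
    · -- μ(Da) = 0
      have hFa0 : μ.real (Fa ∩ Da) = 0 := le_antisymm (h ▸ hFaDa) h0FaDa
      rw [hFa0, h]
      nlinarith [h0FDK, h0Dt]
    · -- μ({t ↮ c}) = 0 ⟹ μ(Dt) = 0
      have hDt0 : μ.real Dt = 0 := le_antisymm (h ▸ hDtle) h0Dt
      have hFt0 : μ.real (Ft ∩ Dt) = 0 := le_antisymm (hDt0 ▸ hFtDt) h0FtDt
      rw [hFt0, hDt0]
      nlinarith [h0FDK, h0Da]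
  · have hMpos : 0 < μ.real M := lt_of_le_of_ne h0M (Ne.symm hM0)
    exact le_of_mul_le_mul_left hchain hMpos

end KNGoodPocketBHK

end Summit.CriticalPhenomena.PercolationContinuityZ3.Theorems
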